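import Summits.BirchSwinnertonDyer.BirchSwinnertonDyer.Theorems.ThetaPartnerAtTwoSignedMainConjectureCMTwoRankZeroFlatTwistImaginaryPrint
import Summits.BirchSwinnertonDyer.BirchSwinnertonDyer.Theorems.ThetaPartnerAtTwoSignedMainConjectureCMTwoRankZeroFlatTwistMinusCRT
import HarnessLib

/-!
# Route `ThetaPartnerAtTwo`, crux K2r0P `SignedMainConjectureCMTwoRankZeroOfPub` (stmt-BirchSwinnertonDyer-24945),
# line `rankzero` v14, stub (μ♭)_A: imaginary SQUARE-FREE twists (composite `|d|`, e.g. `27a^{(−55)} = 81675i`,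
# `27a^{(−115)} = 357075bh`) — the plus/minus congruence, the certificate equivalence, the sibling transport, and the
# Abbes–Ullmo (print) versions

Cell `bsd-wall`, width seat `bsd-wall-tp2-p2-w3` (g2). THEOREMS ONLY (no `def`, no named fact, no `sorry`); helper `--supports`
the crux; sequel of `…FlatTwistImaginaryPrint` and `…FlatTwistMinusCRT`. The prime-`|d|` theorems of `…FlatTwistImaginary*`
verbatim with `exists_dilationSetMinus_twistedSum` (square-free `|d|`) for `exists_dilationSetMinus_prime`; the minus-period
unit H⁻(W) is displayed in §1–§2 and discharged from the named fact `abbesUllmo_not_dvd_maninConstant_of_not_dvd_level` in §3.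
BSD is not proved by any of this.

References: B. Mazur, J. Tate, J. Teitelbaum, Invent. Math. 84 (1986) §I.4 (4.2), §I.8 [MazurTateTeitelbaum1986Invent];
V. Pal, Proc. AMS 140 (2012) Thm. 3.2 [Pal2012]; G. Shimura (1971) Prop. 3.64 [Shimura1971]; R. Pollack, Duke Math. J. 118
(2003) Prop. 6.18 [Pollack2003]; S. Kobayashi, Invent. Math. 152 (2003) Thm. 1.2 [Kobayashi2003]; A. Abbes, E. Ullmo,
Compositio Math. 103 (1996) Thm. A [AbbesUllmo1996].
-/

set_option autoImplicit false
-- the Theorems namespace of this sub repeats the summit name by design (D-0017 nested layout)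
set_option linter.dupNamespace false

noncomputable section

open scoped Classical MatrixGroups ModularForm NumberField NumberTheorySymbols

open NumberField IsDedekindDomain Rat.HeightOneSpectrum CongruenceSubgroup
  Literature.NumberTheory.EllipticCurves Literature.NumberTheory.GaloisRepresentations
  WeierstrassCurve Literature.NumberTheory.EllipticCurves.ModularForms Literature.NumberTheory.EllipticCurves.Rank1Residual
  Literature.NumberTheory.EllipticCurves.Rank1Residual.Typed
  Summit.BirchSwinnertonDyer.Rank1Residual Summit.BirchSwinnertonDyer.Rank1Residual.Supersingular

namespace Summit.BirchSwinnertonDyer.BirchSwinnertonDyer.Theorems.FlatTwist.Imaginary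

section Squarefree

variable (W : WeierstrassCurve ℚ) [W.IsElliptic] [W.IsGloballyMinimal] {d : ℤ} {A : WeierstrassCurve ℚ}
  [A.IsElliptic] [A.IsGloballyMinimal] [NeZero (W.conductorNorm ℤ)] [NeZero (A.conductorNorm ℤ)]
  {fW : CuspForm (Gamma0 (W.conductorNorm ℤ)) 2} {fA : CuspForm (Gamma0 (A.conductorNorm ℤ)) 2}

/-! ## §1. The plus/minus congruence for an imaginary square-free twist -/

/-- **THE PLUS/MINUS CONGRUENCE FOR AN IMAGINARY SQUARE-FREE TWIST.** Let `W/ℚ` be globally minimal, good at `2` with `2 ∣ a₂(W)`,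
`Δ(W) < 0`; `d < 0` SQUARE-FREE (e.g. `d = −55, −115`), `d ≡ 1 (mod 4)`, `(d, N_W) = 1`; `A` a globally minimal model of `W^{(d)}`; `f_W`, `f_A`
newforms; some `[x]⁺_{f_A} ≠ 0`. Grant modularity (`hmod`), the period unit at `2` (`h2`, used at `A`) and the DISPLAYED
minus-period unit at `W` (`|Ω⁻(W)| = ϖ·Ω⁻_{f_W}`, `|ϖ|₂ = 1`). THEN there is a non-empty odd `S` of divisors of `d²` with, for all
`k ≥ 1`, `b` odd: `2([b/4^k]⁺_{f_A} − [0]⁺_{f_A}) − ∑_{t∈S} 2[tb/4^k]⁻_{f_W} ∈ 2ℤ`.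
[cite: MazurTateTeitelbaum1986Invent, §I.4 (4.2) and §I.8] [cite: Pal2012, Thm. 3.2 (case d < 0)] [cite: Shimura1971, Prop. 3.64] -/
theorem exists_plusMinus_congruence_negTwist_squarefree (hmod : exists_isNewformOf)
    (h2 : Literature.NumberTheory.EllipticCurves.realPeriodRat_eq_unit_mul_plusPeriod_two)
    (hss : GoodSS W 2) (hΔ : W.Δ < 0) (hd : d < 0) (hd4 : d % 4 = 1) (hsq : Squarefree d)
    (hcop : IsCoprime d (W.conductorNorm ℤ : ℤ)) {C : VariableChange ℚ} (hA : C • W.quadraticTwist (d : ℚ) = A)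
    (hfW : IsNewformOf W fW) (hfA : IsNewformOf A fA) (hnz : ∃ x : ℚ, ratPlusSymbol fA x ≠ 0)
    {ϖ : ℚ} (hϖ1 : ‖(ϖ : ℚ_[2])‖ = 1) (hϖ : W.imaginaryPeriodRat = (ϖ : ℝ) * minusPeriod fW) :
    ∃ S : Finset ℕ, S.Nonempty ∧ (∀ t ∈ S, Odd t) ∧
      ∀ k : ℕ, 1 ≤ k → ∀ b : ℤ, Odd b → ∃ z : ℤ,
        2 * (ratPlusSymbol fA ((b : ℚ) / 4 ^ k) - ratPlusSymbol fA 0) -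
          ∑ t ∈ S, 2 * ratMinusSymbol fW ((((t : ℤ) * b : ℤ) : ℚ) / 4 ^ k) = 2 * z := by
  haveI : Fact (Nat.Prime 2) := ⟨Nat.prime_two⟩
  set m : ℕ := d.natAbs with hm_def
  have hd0 : d ≠ 0 := hd.ne
  haveI : NeZero m := ⟨Int.natAbs_ne_zero.mpr hd0⟩
  have hm0 : 0 < m := Nat.pos_of_ne_zero (NeZero.ne m)
  have hsqm : Squarefree m := Int.squarefree_natAbs.mpr hsq
  have hmN' : m.Coprime (W.conductorNorm ℤ) := by
    have h := Int.isCoprime_iff_gcd_eq_one.mp hcop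
    unfold Int.gcd at h
    simpa using h
  have hmodd : Odd m := Int.natAbs_odd.mpr (Int.odd_iff.mpr (by omega))
  -- Birch (odd) with its period constant
  obtain ⟨χ, hχ⟩ := exists_mulChar_int_eq_jacobiSym m
  obtain ⟨c, hc, hcsq⟩ := exists_ratPlusSymbol_negTwist_eq_sum_and_sq W hmod hd hd4 hsq hcop hA hfW hfA hχ
  -- reduction data
  have h2d : ¬ (2 : ℤ) ∣ d := by omega
  obtain ⟨hgoodA, haA⟩ := hasGoodReductionAtPrime_twist_and_frobeniusTrace_eq W 2 hmod hd4 hsq hcop hA hss.1 h2d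
  have hssA : GoodSS A 2 := ⟨hgoodA, by rw [haA]; exact dvd_mul_of_dvd_right hss.2 _⟩
  -- integral Hecke eigenvalues of `f_W` at the primes of `m` (all good for `W`)
  have hint : ∀ ℓ : ℕ, ℓ.Prime → ℓ ∣ m → ∃ a : ℤ, cuspCoeff fW ℓ = a := by
    intro ℓ hℓ hℓm
    haveI : Fact ℓ.Prime := ⟨hℓ⟩
    have hℓN : ¬ ℓ ∣ W.conductorNorm ℤ := fun h ↦
      hℓ.one_lt.ne' (Nat.Coprime.eq_one_of_dvd (Nat.Coprime.coprime_dvd_left hℓm hmN') h)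
    have hgoodℓ : W.HasGoodReductionAtPrime ℓ := by
      by_contra h
      exact hℓN ((W.dvd_conductorNorm_iff_not_hasGoodReductionAtPrime ℓ).mpr h)
    exact ⟨W.frobeniusTrace ℓ, cuspCoeff_eq_frobeniusTrace_of_isNewformOf_holds hfW hgoodℓ⟩
  have h2NW : ¬ 2 ∣ W.conductorNorm ℤ := not_dvd_level_of_isNewformOf hfW hss.1
  have h2NA : ¬ 2 ∣ A.conductorNorm ℤ := not_dvd_level_of_isNewformOf hfA hgoodA
  have hrealW : ∀ n, (cuspCoeff fW n).im = 0 := cuspCoeff_im_eq_zero_of_coeffField_eq_bot hfW.coeffField_eq_bot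
  have hrealA : ∀ n, (cuspCoeff fA n).im = 0 := cuspCoeff_im_eq_zero_of_coeffField_eq_bot hfA.coeffField_eq_bot
  -- the minus dilation set of the square-free `m` for `f_W`
  obtain ⟨S, hS, hSd, hQS⟩ := FlatTwist.exists_dilationSetMinus_twistedSum fW hfW.1 hfW.coeffField_eq_bot m hsqm hmN' hint
  -- `|c|₂ = 1`: `h2` at `A`, Pal for `d < 0`, one real component, the displayed minus unit at `W`
  obtain ⟨uA, huA1, huA⟩ := h2 A hssA.1 (P2.irr_two_of_goodSS_two A hssA) fA hfA
  have hV : ∀ v : HeightOneSpectrum (𝓞 ℚ), ((primesEquiv v : ℕ) : ℤ) ∣ d →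
      W.HasGoodReductionAt v ∨ W.HasMultiplicativeReductionAt v := by
    intro v hvd
    left
    refine hasGoodReductionAt_of_not_dvd_conductorNorm W v fun hvN ↦ ?_
    have hℓ : ((primesEquiv v : ℕ)).Prime := (primesEquiv v).2
    have hu := Int.isUnit_iff_natAbs_eq.mp (hcop.isUnit_of_dvd' hvd (Int.natCast_dvd_natCast.mpr hvN))
    rw [Int.natAbs_natCast] at hu
    exact hℓ.one_lt.ne' hu
  have hPal := W.realPeriodRat_mul_sqrt_eq_of_twist_of_neg_of_squarefree hd hd4 hsq hV A C hA
  rw [numRealComponents_twistModel_eq_one W hΔ hd0 hA, Nat.cast_one, one_mul] at hPal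
  have hmZ : ((m : ℕ) : ℤ) = -d := Int.ofNat_natAbs_of_nonpos hd.le
  have hmR' : (m : ℝ) = -(d : ℝ) := by exact_mod_cast hmZ
  have hmR : Real.sqrt (-(d : ℝ)) = Real.sqrt (m : ℝ) := by rw [hmR']
  rw [hmR] at hPal
  have hcu : ‖(c : ℚ_[2])‖ = 1 :=
    norm_birchConst_eq_one_of_neg hm0 (IsNewform0.plusPeriod_pos_holds hfA.1 hfA.coeffField_eq_bot)
      (hcsq hnz) huA hPal hϖ huA1 hϖ1
  refine ⟨S, hS, fun t ht ↦ (hmodd.pow (n := 2)).of_dvd_nat (hSd t ht), ?_⟩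
  intro k hk b hb
  set x : ℚ := (b : ℚ) / 4 ^ k with hx_def
  have h4pow : ((4 : ℚ) ^ k) = 2 ^ (2 * k) := by rw [pow_mul]; norm_num
  have hxW : x.den.Coprime (W.conductorNorm ℤ) := by
    rw [hx_def, h4pow]; exact SignedMuAtTwo.coprime_den_div_two_pow h2NW b (2 * k)
  have hxA : x.den.Coprime (A.conductorNorm ℤ) := by
    rw [hx_def, h4pow]; exact SignedMuAtTwo.coprime_den_div_two_pow h2NA b (2 * k)
  obtain ⟨z₁, hz₁⟩ := hQS x hxW
  choose i hi using fun t : ℕ ↦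
    exists_two_mul_ratMinusSymbol_eq_intCast fW hrealW (coprime_den_natCast_mul hxW t)
  obtain ⟨mA, hmA⟩ := SignedMuAtTwo.exists_two_mul_ratPlusSymbol_sub_eq_intCast fA hrealA hxA
  have hMA : (mA : ℚ) = c * ((∑ t ∈ S, i t : ℤ) + 2 * z₁) := by
    have hx1 := hc x
    have hx0 := hc 0
    simp only [zero_add] at hx0
    have hsumI : (∑ t ∈ S, 2 * ratMinusSymbol fW ((t : ℚ) * x)) = ((∑ t ∈ S, i t : ℤ) : ℚ) := by
      push_cast
      exact Finset.sum_congr rfl fun t _ ↦ hi t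
    have h2 : 2 * (c * ∑ u : ZMod m, (J((u.val : ℤ) | m) : ℚ) * ratMinusSymbol fW (x + (u.val : ℚ) / m) -
        c * ∑ u : ZMod m, (J((u.val : ℤ) | m) : ℚ) * ratMinusSymbol fW ((u.val : ℚ) / m)) =
        c * ∑ u : ZMod m, (J((u.val : ℤ) | m) : ℚ) *
          (2 * ratMinusSymbol fW (x + (u.val : ℚ) / m) - 2 * ratMinusSymbol fW ((u.val : ℚ) / m)) := by
      rw [← mul_sub, ← Finset.sum_sub_distrib, Finset.mul_sum, Finset.mul_sum, Finset.mul_sum]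
      exact Finset.sum_congr rfl fun u _ ↦ by ring
    rw [← hmA, hx1, hx0, h2, hz₁, hsumI]
  obtain ⟨z₂, hz₂⟩ := FlatTwist.exists_sub_eq_two_mul_of_eq_unit_mul (J := (∑ t ∈ S, i t) + 2 * z₁) hcu
    (by rw [hMA]; push_cast; ring)
  refine ⟨z₂ + z₁, ?_⟩
  have hsum : ∑ t ∈ S, 2 * ratMinusSymbol fW ((((t : ℤ) * b : ℤ) : ℚ) / 4 ^ k) = ((∑ t ∈ S, i t : ℤ) : ℚ) := by
    push_cast
    refine Finset.sum_congr rfl fun t _ ↦ ?_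
    rw [← hi t, hx_def]
    ring_nf
  rw [hsum, hmA]
  have hz₂' : (mA : ℚ) - ((∑ t ∈ S, i t : ℤ) + 2 * z₁ : ℤ) = 2 * z₂ := by exact_mod_cast hz₂
  push_cast at hz₂' ⊢
  linear_combination hz₂'


/-! ## §2. Certificate equivalence, FLAT and siblings for imaginary square-free twists -/

/-- **MINUS CERTIFICATE AT THE BASE ⟹ PLUS CERTIFICATE AT THE IMAGINARY SQUARE-FREE TWIST.** `W` globally minimal, good at `2` with
`2 ∣ a₂(W)`, `Δ(W) < 0`; `d < 0`, `d` square-free, `d ≡ 1 (mod 4)`, `(d, N_W) = 1`; `A` a globally minimal model of `W^{(d)}`; newforms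
`f_W`, `f_A`; some `[x]⁺_{f_A} ≠ 0`; granted `hmod`, `h2` and the displayed minus unit `Ω⁻(W) = ϖ·Ω⁻_{f_W}`, `|ϖ|₂ = 1`. If some
`2[b/4^k]⁻_{f_W}` (`k ≥ 1`, `b` odd) is ODD, then some `[b'/4^{k'}]⁺_{f_A} − [0]⁺_{f_A}` is half an odd integer.
[cite: MazurTateTeitelbaum1986Invent, §I.4 (4.2), §I.8] [cite: Pal2012, Thm. 3.2 (case d < 0)] [cite: EmertonPollackWeston2006, §4.4] -/
theorem exists_odd_negTwist_of_exists_oddMinus_squarefree (hmod : exists_isNewformOf)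
    (h2 : Literature.NumberTheory.EllipticCurves.realPeriodRat_eq_unit_mul_plusPeriod_two)
    (hss : GoodSS W 2) (hΔ : W.Δ < 0) (hd : d < 0) (hd4 : d % 4 = 1) (hsq : Squarefree d)
    (hcop : IsCoprime d (W.conductorNorm ℤ : ℤ)) {C : VariableChange ℚ} (hA : C • W.quadraticTwist (d : ℚ) = A)
    (hfW : IsNewformOf W fW) (hfA : IsNewformOf A fA) (hnz : ∃ x : ℚ, ratPlusSymbol fA x ≠ 0)
    {ϖ : ℚ} (hϖ1 : ‖(ϖ : ℚ_[2])‖ = 1) (hϖ : W.imaginaryPeriodRat = (ϖ : ℝ) * minusPeriod fW)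
    (hres : ∃ k : ℕ, 1 ≤ k ∧ ∃ b : ℤ, Odd b ∧ ∃ m : ℤ, Odd m ∧ 2 * ratMinusSymbol fW ((b : ℚ) / 4 ^ k) = m) :
    ∃ k : ℕ, 1 ≤ k ∧ ∃ b : ℤ, Odd b ∧ ∃ m : ℤ, Odd m ∧
      ratPlusSymbol fA ((b : ℚ) / 4 ^ k) = ratPlusSymbol fA 0 + (m : ℚ) / 2 := by
  haveI : Fact (Nat.Prime 2) := ⟨Nat.prime_two⟩
  obtain ⟨S, hS, hodd, hcong⟩ :=
    exists_plusMinus_congruence_negTwist_squarefree W hmod h2 hss hΔ hd hd4 hsq hcop hA hfW hfA hnz hϖ1 hϖ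
  have h2d : ¬ (2 : ℤ) ∣ d := by omega
  obtain ⟨hgoodA, -⟩ := hasGoodReductionAtPrime_twist_and_frobeniusTrace_eq W 2 hmod hd4 hsq hcop hA hss.1 h2d
  have h2NA : ¬ 2 ∣ A.conductorNorm ℤ := not_dvd_level_of_isNewformOf hfA hgoodA
  have h2NW : ¬ 2 ∣ W.conductorNorm ℤ := not_dvd_level_of_isNewformOf hfW hss.1
  have haW2 : cuspCoeff fW 2 = ((W.frobeniusTrace 2 : ℤ) : ℂ) := cuspCoeff_eq_frobeniusTrace_of_isNewformOf_holds hfW hss.1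
  have haev : Even (W.frobeniusTrace 2) := even_iff_two_dvd.mpr hss.2
  exact exists_odd_of_plusMinus_congruence fA fW hfA.coeffField_eq_bot h2NA hfW.1 hfW.coeffField_eq_bot h2NW haW2 haev
    S hS hodd hcong hres

/-- **PLUS CERTIFICATE AT THE IMAGINARY SQUARE-FREE TWIST ⟹ MINUS CERTIFICATE AT THE BASE** (same setting; the non-vanishing of some
`[x]⁺_{f_A}` follows from the certificate itself). So, granted the displayed minus unit at `W`, «some `2[b/4^k]⁻_{f_W}` is odd» is
the common invariant of ALL admissible imaginary square-free twists of `W`. [cite: MazurTateTeitelbaum1986Invent, §I.8] [cite: Pal2012, Thm. 3.2] -/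
theorem exists_oddMinus_of_exists_odd_negTwist_squarefree (hmod : exists_isNewformOf)
    (h2 : Literature.NumberTheory.EllipticCurves.realPeriodRat_eq_unit_mul_plusPeriod_two)
    (hss : GoodSS W 2) (hΔ : W.Δ < 0) (hd : d < 0) (hd4 : d % 4 = 1) (hsq : Squarefree d)
    (hcop : IsCoprime d (W.conductorNorm ℤ : ℤ)) {C : VariableChange ℚ} (hA : C • W.quadraticTwist (d : ℚ) = A)
    (hfW : IsNewformOf W fW) (hfA : IsNewformOf A fA)
    {ϖ : ℚ} (hϖ1 : ‖(ϖ : ℚ_[2])‖ = 1) (hϖ : W.imaginaryPeriodRat = (ϖ : ℝ) * minusPeriod fW)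
    (hres : ∃ k : ℕ, 1 ≤ k ∧ ∃ b : ℤ, Odd b ∧ ∃ m : ℤ, Odd m ∧
      ratPlusSymbol fA ((b : ℚ) / 4 ^ k) = ratPlusSymbol fA 0 + (m : ℚ) / 2) :
    ∃ k : ℕ, 1 ≤ k ∧ ∃ b : ℤ, Odd b ∧ ∃ m : ℤ, Odd m ∧ 2 * ratMinusSymbol fW ((b : ℚ) / 4 ^ k) = m := by
  haveI : Fact (Nat.Prime 2) := ⟨Nat.prime_two⟩
  have hnz : ∃ x : ℚ, ratPlusSymbol fA x ≠ 0 := by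
    obtain ⟨k, -, b, -, m, hmo, hmeq⟩ := hres
    by_contra hall
    push Not at hall
    rw [hall, hall] at hmeq
    have hm0 : (m : ℚ) = 0 := by linarith
    have : m = 0 := by exact_mod_cast hm0
    rw [this] at hmo
    exact (by decide : ¬ Odd (0 : ℤ)) hmo
  obtain ⟨S, -, hodd, hcong⟩ :=
    exists_plusMinus_congruence_negTwist_squarefree W hmod h2 hss hΔ hd hd4 hsq hcop hA hfW hfA hnz hϖ1 hϖ
  have h2NW : ¬ 2 ∣ W.conductorNorm ℤ := not_dvd_level_of_isNewformOf hfW hss.1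
  exact exists_oddMinus_of_plusMinus_congruence fA fW hfW.coeffField_eq_bot h2NW S hodd hcong hres

/-- **FLAT AT AN IMAGINARY SQUARE-FREE TWIST from the minus certificate at the base** (`a₂(W) = 0`, `L(A,1) ≠ 0`): for every Pollack
pair `(L♯, L♭)` of `f_A` at `2`, `2 ∤ L♭`. [cite: Pollack2003, Prop. 6.18] [cite: MazurTateTeitelbaum1986Invent, §I.8] -/
theorem flatAtTwo_negTwist_of_exists_oddMinus_squarefree (hmod : exists_isNewformOf)
    (h2 : Literature.NumberTheory.EllipticCurves.realPeriodRat_eq_unit_mul_plusPeriod_two)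
    (hss : GoodSS W 2) (haW : W.frobeniusTrace 2 = 0) (hΔ : W.Δ < 0) (hd : d < 0) (hd4 : d % 4 = 1)
    (hsq : Squarefree d) (hcop : IsCoprime d (W.conductorNorm ℤ : ℤ)) {C : VariableChange ℚ}
    (hA : C • W.quadraticTwist (d : ℚ) = A) (hfW : IsNewformOf W fW) (hfA : IsNewformOf A fA)
    (hLA : A.entireLFunction 1 ≠ 0)
    {ϖ : ℚ} (hϖ1 : ‖(ϖ : ℚ_[2])‖ = 1) (hϖ : W.imaginaryPeriodRat = (ϖ : ℝ) * minusPeriod fW)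
    (hres : ∃ k : ℕ, 1 ≤ k ∧ ∃ b : ℤ, Odd b ∧ ∃ m : ℤ, Odd m ∧ 2 * ratMinusSymbol fW ((b : ℚ) / 4 ^ k) = m) :
    ∀ Lplus Lminus : IwasawaAlgebra 2, IsPollackPair fA 2 Lplus Lminus → ¬ PowerSeries.C (2 : ℤ_[2]) ∣ Lminus := by
  haveI : Fact (Nat.Prime 2) := ⟨Nat.prime_two⟩
  have hnz : ∃ x : ℚ, ratPlusSymbol fA x ≠ 0 :=
    ⟨0, fun h ↦ hLA (by rw [hfA.entireLFunction_one_eq, h]; simp)⟩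
  have hresA := exists_odd_negTwist_of_exists_oddMinus_squarefree W hmod h2 hss hΔ hd hd4 hsq hcop hA hfW hfA hnz hϖ1 hϖ hres
  have h2d : ¬ (2 : ℤ) ∣ d := by omega
  obtain ⟨hgoodA, haA⟩ := hasGoodReductionAtPrime_twist_and_frobeniusTrace_eq W 2 hmod hd4 hsq hcop hA hss.1 h2d
  have haA0 : A.frobeniusTrace 2 = 0 := by rw [haA, haW, mul_zero]
  have hssA : GoodSS A 2 := ⟨hgoodA, by rw [haA0]; exact dvd_zero _⟩
  have h2NA : ¬ 2 ∣ A.conductorNorm ℤ := not_dvd_level_of_isNewformOf hfA hgoodA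
  have haA2 : cuspCoeff fA 2 = ((0 : ℤ) : ℂ) := by
    rw [cuspCoeff_eq_frobeniusTrace_of_isNewformOf_holds hfA hgoodA, haA0]
  -- the old-class FLAT lemma with the trivial class `S = {1}`, `g = f_A`
  refine SignedMuAtTwo.flatAtTwo_of_plusSymbol_congruence hfA hssA haA0 fA hfA.1 hfA.coeffField_eq_bot h2NA haA2
    (by decide) {1} (Finset.singleton_nonempty 1) (fun t ht ↦ by rw [Finset.mem_singleton.mp ht]; exact odd_one) ?_ hresA
  intro k _ b _
  refine ⟨0, ?_⟩
  rw [Finset.sum_singleton]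
  push_cast
  ring

/-- The same in the registered stub's currency `∃ n, IsUnit (coeff n (kobayashiL 1 L⁺ L⁻))`.
[cite: Kobayashi2003, Thm. 1.2] [cite: Pollack2003, Prop. 6.18] -/
theorem analyticMuFlat_negTwist_at_of_exists_oddMinus_squarefree (hmod : exists_isNewformOf)
    (h2 : Literature.NumberTheory.EllipticCurves.realPeriodRat_eq_unit_mul_plusPeriod_two)
    (hss : GoodSS W 2) (haW : W.frobeniusTrace 2 = 0) (hΔ : W.Δ < 0) (hd : d < 0) (hd4 : d % 4 = 1)
    (hsq : Squarefree d) (hcop : IsCoprime d (W.conductorNorm ℤ : ℤ)) {C : VariableChange ℚ}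
    (hA : C • W.quadraticTwist (d : ℚ) = A) (hfW : IsNewformOf W fW) (hfA : IsNewformOf A fA)
    (hLA : A.entireLFunction 1 ≠ 0)
    {ϖ : ℚ} (hϖ1 : ‖(ϖ : ℚ_[2])‖ = 1) (hϖ : W.imaginaryPeriodRat = (ϖ : ℝ) * minusPeriod fW)
    (hres : ∃ k : ℕ, 1 ≤ k ∧ ∃ b : ℤ, Odd b ∧ ∃ m : ℤ, Odd m ∧ 2 * ratMinusSymbol fW ((b : ℚ) / 4 ^ k) = m)
    (Lplus Lminus : IwasawaAlgebra 2) (hPP : IsPollackPair fA 2 Lplus Lminus) :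
    ∃ n : ℕ, IsUnit (PowerSeries.coeff n (kobayashiL 1 Lplus Lminus)) := by
  rw [kobayashiL_one]
  exact exists_isUnit_coeff_of_not_C_two_dvd
    (flatAtTwo_negTwist_of_exists_oddMinus_squarefree W hmod h2 hss haW hΔ hd hd4 hsq hcop hA hfW hfA hLA hϖ1 hϖ hres Lplus
      Lminus hPP)

/-- **(μ♭) AT AN IMAGINARY SQUARE-FREE TWIST FROM A SIBLING.** Same base `W` (`a₂(W) = 0`, `Δ(W) < 0`, displayed minus unit), two
imaginary square-free twists: `A₁` a globally minimal model of `W^{(d₁)}` carrying the plus certificate (e.g. level-16-certified, or on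
the unit zone, or FLAT of rank `0`), and `A` one of `W^{(d)}` with `L(A,1) ≠ 0`. Then (μ♭) holds at every Pollack pair of `f_A`.
[cite: MazurTateTeitelbaum1986Invent, §I.8] [cite: Pal2012, Thm. 3.2 (case d < 0)] [cite: Pollack2003, Prop. 6.18] -/
theorem analyticMuFlat_negTwist_at_of_sibling_squarefree (hmod : exists_isNewformOf)
    (h2 : Literature.NumberTheory.EllipticCurves.realPeriodRat_eq_unit_mul_plusPeriod_two)
    (hss : GoodSS W 2) (haW : W.frobeniusTrace 2 = 0) (hΔ : W.Δ < 0) (hfW : IsNewformOf W fW)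
    {ϖ : ℚ} (hϖ1 : ‖(ϖ : ℚ_[2])‖ = 1) (hϖ : W.imaginaryPeriodRat = (ϖ : ℝ) * minusPeriod fW)
    {d₁ : ℤ} (hd₁ : d₁ < 0) (hd₁4 : d₁ % 4 = 1) (hsq₁ : Squarefree d₁) (hcop₁ : IsCoprime d₁ (W.conductorNorm ℤ : ℤ))
    {A₁ : WeierstrassCurve ℚ} [A₁.IsElliptic] [A₁.IsGloballyMinimal] [NeZero (A₁.conductorNorm ℤ)] {C₁ : VariableChange ℚ}
    (hA₁ : C₁ • W.quadraticTwist (d₁ : ℚ) = A₁) {f₁ : CuspForm (Gamma0 (A₁.conductorNorm ℤ)) 2} (hf₁ : IsNewformOf A₁ f₁)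
    (hres : ∃ k : ℕ, 1 ≤ k ∧ ∃ b : ℤ, Odd b ∧ ∃ m : ℤ, Odd m ∧
      ratPlusSymbol f₁ ((b : ℚ) / 4 ^ k) = ratPlusSymbol f₁ 0 + (m : ℚ) / 2)
    (hd : d < 0) (hd4 : d % 4 = 1) (hsq : Squarefree d) (hcop : IsCoprime d (W.conductorNorm ℤ : ℤ))
    {C : VariableChange ℚ} (hA : C • W.quadraticTwist (d : ℚ) = A) (hfA : IsNewformOf A fA)
    (hLA : A.entireLFunction 1 ≠ 0) (Lplus Lminus : IwasawaAlgebra 2) (hPP : IsPollackPair fA 2 Lplus Lminus) :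
    ∃ n : ℕ, IsUnit (PowerSeries.coeff n (kobayashiL 1 Lplus Lminus)) :=
  analyticMuFlat_negTwist_at_of_exists_oddMinus_squarefree W hmod h2 hss haW hΔ hd hd4 hsq hcop hA hfW hfA hLA hϖ1 hϖ
    (exists_oddMinus_of_exists_odd_negTwist_squarefree W hmod h2 hss hΔ hd₁ hd₁4 hsq₁ hcop₁ hA₁ hfW hf₁ hϖ1 hϖ hres)
    Lplus Lminus hPP

/-! ## §3. From print: H⁻(W) discharged by Abbes–Ullmo -/

/-- **(μ♭) AT AN IMAGINARY SQUARE-FREE TWIST FROM A SIBLING, FROM PRINT** (granted `hmod` + Abbes–Ullmo `hAU` only): base `W`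
globally minimal, good supersingular at `2` with `a₂(W) = 0`, `Δ(W) < 0`; `A₁ = W^{(d₁)}` carrying the plus certificate and
`A = W^{(d)}` with `L(A,1) ≠ 0`, `d₁, d < 0` square-free, `≡ 1 (mod 4)`, coprime to `N_W`.
[cite: AbbesUllmo1996, Thm. A] [cite: MazurTateTeitelbaum1986Invent, §I.8] [cite: Pal2012, Thm. 3.2 (case d < 0)] [cite: Pollack2003, Prop. 6.18] -/
theorem analyticMuFlat_negTwist_at_of_sibling_squarefree_of_abbesUllmo (hmod : exists_isNewformOf)
    (hAU : abbesUllmo_not_dvd_maninConstant_of_not_dvd_level)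
    (hss : GoodSS W 2) (haW : W.frobeniusTrace 2 = 0) (hΔ : W.Δ < 0) (hfW : IsNewformOf W fW)
    {d₁ : ℤ} (hd₁ : d₁ < 0) (hd₁4 : d₁ % 4 = 1) (hsq₁ : Squarefree d₁) (hcop₁ : IsCoprime d₁ (W.conductorNorm ℤ : ℤ))
    {A₁ : WeierstrassCurve ℚ} [A₁.IsElliptic] [A₁.IsGloballyMinimal] [NeZero (A₁.conductorNorm ℤ)] {C₁ : VariableChange ℚ}
    (hA₁ : C₁ • W.quadraticTwist (d₁ : ℚ) = A₁) {f₁ : CuspForm (Gamma0 (A₁.conductorNorm ℤ)) 2} (hf₁ : IsNewformOf A₁ f₁)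
    (hres : ∃ k : ℕ, 1 ≤ k ∧ ∃ b : ℤ, Odd b ∧ ∃ m : ℤ, Odd m ∧
      ratPlusSymbol f₁ ((b : ℚ) / 4 ^ k) = ratPlusSymbol f₁ 0 + (m : ℚ) / 2)
    (hd : d < 0) (hd4 : d % 4 = 1) (hsq : Squarefree d) (hcop : IsCoprime d (W.conductorNorm ℤ : ℤ))
    {C : VariableChange ℚ} (hA : C • W.quadraticTwist (d : ℚ) = A) (hfA : IsNewformOf A fA)
    (hLA : A.entireLFunction 1 ≠ 0) (Lplus Lminus : IwasawaAlgebra 2) (hPP : IsPollackPair fA 2 Lplus Lminus) :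
    ∃ n : ℕ, IsUnit (PowerSeries.coeff n (kobayashiL 1 Lplus Lminus)) := by
  obtain ⟨ϖ, hϖ1, hϖ⟩ := exists_minusUnit_of_abbesUllmo W hAU hss hΔ fW hfW
  exact analyticMuFlat_negTwist_at_of_sibling_squarefree W hmod
    (SkinnerUrban2014.realPeriodRat_eq_unit_mul_plusPeriod_two_fact_of_abbesUllmo hAU) hss haW hΔ hfW hϖ1 hϖ hd₁ hd₁4 hsq₁
    hcop₁ hA₁ hf₁ hres hd hd4 hsq hcop hA hfA hLA Lplus Lminus hPP

/-- **FLAT IS CLOSED UNDER PASSING BETWEEN IMAGINARY SQUARE-FREE TWISTS, FROM PRINT**: FLAT at a rank-`0` sibling `(A₁, f₁)`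
⇒ (μ♭) at `A`. [cite: AbbesUllmo1996, Thm. A] [cite: Pollack2003, Prop. 6.18] -/
theorem analyticMuFlat_negTwist_at_of_flatAtTwo_anchor_squarefree_of_abbesUllmo (hmod : exists_isNewformOf)
    (hAU : abbesUllmo_not_dvd_maninConstant_of_not_dvd_level)
    (hss : GoodSS W 2) (haW : W.frobeniusTrace 2 = 0) (hΔ : W.Δ < 0) (hfW : IsNewformOf W fW)
    {d₁ : ℤ} (hd₁ : d₁ < 0) (hd₁4 : d₁ % 4 = 1) (hsq₁ : Squarefree d₁) (hcop₁ : IsCoprime d₁ (W.conductorNorm ℤ : ℤ))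
    {A₁ : WeierstrassCurve ℚ} [A₁.IsElliptic] [A₁.IsGloballyMinimal] [NeZero (A₁.conductorNorm ℤ)] {C₁ : VariableChange ℚ}
    (hA₁ : C₁ • W.quadraticTwist (d₁ : ℚ) = A₁) {f₁ : CuspForm (Gamma0 (A₁.conductorNorm ℤ)) 2} (hf₁ : IsNewformOf A₁ f₁)
    (hr₁ : A₁.analyticRank = 0)
    (hflat₁ : ∀ Lplus Lminus : IwasawaAlgebra 2, IsPollackPair f₁ 2 Lplus Lminus → ¬ PowerSeries.C (2 : ℤ_[2]) ∣ Lminus)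
    (hd : d < 0) (hd4 : d % 4 = 1) (hsq : Squarefree d) (hcop : IsCoprime d (W.conductorNorm ℤ : ℤ))
    {C : VariableChange ℚ} (hA : C • W.quadraticTwist (d : ℚ) = A) (hfA : IsNewformOf A fA)
    (hLA : A.entireLFunction 1 ≠ 0) (Lplus Lminus : IwasawaAlgebra 2) (hPP : IsPollackPair fA 2 Lplus Lminus) :
    ∃ n : ℕ, IsUnit (PowerSeries.coeff n (kobayashiL 1 Lplus Lminus)) := by
  haveI : Fact (Nat.Prime 2) := ⟨Nat.prime_two⟩
  have h2d₁ : ¬ (2 : ℤ) ∣ d₁ := by omega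
  obtain ⟨hgood₁, ha₁⟩ := hasGoodReductionAtPrime_twist_and_frobeniusTrace_eq W 2 hmod hd₁4 hsq₁ hcop₁ hA₁ hss.1 h2d₁
  have ha₁0 : A₁.frobeniusTrace 2 = 0 := by rw [ha₁, haW, mul_zero]
  have hss₁ : GoodSS A₁ 2 := ⟨hgood₁, by rw [ha₁0]; exact dvd_zero _⟩
  have hres := FlatTwist.Squarefree.exists_odd_of_flatAtTwo hf₁ hss₁ ha₁0 hr₁ hflat₁
  exact analyticMuFlat_negTwist_at_of_sibling_squarefree_of_abbesUllmo W hmod hAU hss haW hΔ hfW hd₁ hd₁4 hsq₁ hcop₁ hA₁ hf₁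
    hres hd hd4 hsq hcop hA hfA hLA Lplus Lminus hPP

end Squarefree

end Summit.BirchSwinnertonDyer.BirchSwinnertonDyer.Theorems.FlatTwist.Imaginary

end
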